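import Summits.QuantumAdvantage.QuantumAdvantage.Theorems.CubicForrelationSignedExactCubicForrelationNotPrBPPGrowMachineSpec

/-!
# Crux `CubicForrelation.SignedExactCubicForrelationNotPrBPP` (stmt-QuantumAdvantage-13932), line `dual-pingpong-frame`
# (GROW reshape): the GROW machine, IV′ — span finsets, bases, the rank test, kernels and the candidate

Proof-only support file (`--supports stmt-QuantumAdvantage-13932`) toward the registered stub `stub_growFinder`; sequel
of `…GrowMachineSpec.lean` (second half of the dictionary between the list bricks and the coordinate-free vocabulary):
span induction on the span finset `MMReadout.spanV` of a row list (`spanV_induction`), the unit vectors span everything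
(`mem_spanV_units`), `basisOf` keeps the span and has the rank as length, **the rank test `inSpan` is membership in the
span finset** (`inSpan_eq_true_iff`), the span of the kernel basis `kerOf` is the kernel (`mem_spanV_kerOf_iff`),
`(ker M)^⊥ ⊆ span M`, and the candidate `candV` is the kernel parametrisation `MMReadout.kcV` of the candidate rows, with
its fibre counts (`F2Elim.card_filter_sum_smul_kvec_eq`).

## References

* D. E. Knuth, *TAOCP* Vol. 2, 3rd ed., §4.6.2 Algorithm N. [KnuthTAOCP2]
* J. von zur Gathen, J. Gerhard, *Modern Computer Algebra*, 3rd ed., CUP 2013, §12.1. [VonzurgathenGerhard2013]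
-/

noncomputable section

set_option linter.dupNamespace false -- D-0017: single-problem summit ⇒ `QuantumAdvantage.QuantumAdvantage` by design

namespace Summit.QuantumAdvantage.QuantumAdvantage.Theorems.SignedExactCubicForrelationNotPrBPP.GrowMachine

open Finset
open Literature.Computability.Complexity Literature.Computability.QuantumComplexity
open Literature.Computability.Complexity.F2Elim
open Literature.Computability.Complexity.BLR (toZ toZ_xor toZ_and toZ_injective)
open Literature.Computability.QuantumComplexity.BuzetChailloux (bxor zeroVec bxor_self bxor_comm bxor_zeroVec zeroVec_bxor)
open PolarGeometry (toZ_bdot bdot_comm bdot_bxor_left bdot_bxor_right bxor_bxor_swap bxor_bxor_assoc)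
open NoTrap (bdot_zeroVec bdot_unit D_symm D_bxor_left D_zeroVec_eq D3_swap D3_basefree D3_bxor D3_repr)
open ForrCode QuadSampler MMReadout
open FinderMachine (Vec Mat normV basisOf kerOf inSpan)

variable {n : ℕ}

/-! ### Span finsets of row lists -/

/-- **Span induction**: a property of `0` and of the rows that is closed under `⊕` holds on the span finset. [folklore] -/
theorem spanV_induction {L : List (List Bool)} {P : (Fin n → Bool) → Prop} (h0 : P zeroVec)
    (hrow : ∀ r ∈ L, P (toInput n r)) (hadd : ∀ x y, P x → P y → P (bxor x y)) : ∀ v ∈ spanV n L, P v := by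
  intro v hv
  rw [mem_spanV] at hv
  have key : ∀ t ∈ rowSpan n L, P (zb t) := by
    intro t ht
    induction ht using Submodule.span_induction with
    | mem u hu => obtain ⟨r, hr, rfl⟩ := hu; rw [zb_vecZ]; exact hrow r hr
    | zero => rw [show zb (0 : Fin n → ZMod 2) = zeroVec from by rw [← bz_zeroV, zb_bz]; rfl]; exact h0
    | add u w _ _ hu hw => rw [zb_add]; exact hadd _ _ hu hw
    | smul a u _ hu =>
      rcases toZ_surjective a with ⟨b, rfl⟩
      cases b
      · rw [show toZ false = 0 from rfl, zero_smul, show zb (0 : Fin n → ZMod 2) = zeroVec from by rw [← bz_zeroV, zb_bz]; rfl]; exact h0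
      · rw [show toZ true = 1 from rfl, one_smul]; exact hu
  have := key _ hv
  rwa [zb_bz] at this

/-- **The unit vectors span `{0,1}ⁿ`.** [folklore] -/
theorem mem_spanV_units (y : Fin n → Bool) : y ∈ spanV n ((List.range n).map (unitL n)) := by
  rw [mem_spanV]
  have hy : bz y = ∑ i, toZ (y i) • (Pi.single i 1 : Fin n → ZMod 2) := by
    ext j; simp [Finset.sum_apply, Pi.single_apply]
  rw [hy]
  refine Submodule.sum_mem _ fun i _ => Submodule.smul_mem _ _ (Submodule.subset_span ⟨unitL n i, ?_, ?_⟩)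
  · exact List.mem_map.2 ⟨i, List.mem_range.2 i.isLt, rfl⟩
  · rw [vecZ_eq_bz, toInput_unitL, bz_ev]

/-- Induction over all vectors through the unit vectors. [folklore] -/
theorem unit_induction {P : (Fin n → Bool) → Prop} (h0 : P zeroVec) (hunit : ∀ k : Fin n, P (fun j => decide (j = k)))
    (hadd : ∀ x y, P x → P y → P (bxor x y)) (y : Fin n → Bool) : P y := by
  refine spanV_induction h0 (fun r hr => ?_) hadd y (mem_spanV_units y)
  obtain ⟨i, hi, rfl⟩ := List.mem_map.1 hr
  have e : toInput n (unitL n i) = fun j => decide (j = (⟨i, List.mem_range.1 hi⟩ : Fin n)) := toInput_unitL ⟨i, _⟩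
  rw [e]; exact hunit _

/-- A span finset containing the rows of `L` contains the span of `L`. [folklore] -/
theorem spanV_subset_of_rows {L : List (List Bool)} {W : Finset (Fin n → Bool)} (hW0 : zeroVec ∈ W)
    (hWadd : ∀ x ∈ W, ∀ y ∈ W, bxor x y ∈ W) (hrows : ∀ r ∈ L, toInput n r ∈ W) : spanV n L ⊆ W :=
  fun v hv => spanV_induction (P := fun v => v ∈ W) hW0 hrows (fun x y hx hy => hWadd x hx y hy) v hv

/-- Monotonicity of span finsets in the row list. [folklore] -/
theorem spanV_mono {L L' : List (List Bool)} (h : ∀ r ∈ L, r ∈ L') : spanV n L ⊆ spanV n L' :=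
  spanV_subset_of_rows (zeroVec_mem_spanV L') (fun _ hx _ hy => bxor_mem_spanV hx hy) fun r hr => toInput_mem_spanV (h r hr)

/-- Normalisation does not change the `𝔽₂`-reading. [folklore] -/
theorem vecZ_normV (r : List Bool) : vecZ n (normV n r) = vecZ n r := by
  funext i; rw [vecZ, vecZ, normV]
  congr 1
  rw [List.getD_eq_getElem?_getD, List.getElem?_map, List.getElem?_range i.isLt]; rfl

/-- **`basisOf` keeps the row span.** [cite: KnuthTAOCP2, §4.6.2 Algorithm N] -/
theorem rowSpan_basisOf (M : List (List Bool)) : rowSpan n (basisOf n M) = rowSpan n M := by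
  have hS := inv_rrun n n M
  rw [← rowSpan_rows_eq hS, rowSpan_rows_eq_span_prow hS, rowSpan]
  refine le_antisymm (Submodule.span_le.2 ?_) (Submodule.span_le.2 ?_)
  · rintro v ⟨r, hr, rfl⟩
    obtain ⟨c, hc, rfl⟩ := List.mem_map.1 hr
    obtain ⟨hcn, hcp⟩ := List.mem_filter.1 hc
    rw [vecZ_normV]
    exact Submodule.subset_span ⟨⟨⟨c, List.mem_range.1 hcn⟩, mem_pivs.2 hcp⟩, rfl⟩
  · rintro v ⟨c, rfl⟩
    refine Submodule.subset_span ⟨normV n (prow (rrun n M) c), ?_, vecZ_normV _⟩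
    exact List.mem_map.2 ⟨c, List.mem_filter.2 ⟨List.mem_range.2 c.1.isLt, mem_pivs.1 c.2⟩, rfl⟩

/-- `basisOf` keeps the span finset. [cite: KnuthTAOCP2, §4.6.2 Algorithm N] -/
theorem spanV_basisOf (M : List (List Bool)) : spanV n (basisOf n M) = spanV n M := by
  ext v; rw [mem_spanV, mem_spanV, rowSpan_basisOf]

/-- **`|basisOf M|` is the rank of `M`.** [cite: KnuthTAOCP2, §4.6.2 Algorithm N] -/
theorem length_basisOf (M : List (List Bool)) : (basisOf n M).length = Module.finrank (ZMod 2) (rowSpan n M) := by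
  rw [basisOf, List.length_map, length_filter_isPiv, finrank_rowSpan_eq_card_pivs]

/-- `basisOf M` is a basis of its own span: its length is its rank. [cite: KnuthTAOCP2, §4.6.2 Algorithm N] -/
theorem length_basisOf_eq_finrank_self (M : List (List Bool)) :
    (basisOf n M).length = Module.finrank (ZMod 2) (rowSpan n (basisOf n M)) := by
  rw [rowSpan_basisOf, length_basisOf]

/-- **The span finset has `2^{rank}` elements.** [cite: KnuthTAOCP2, §4.6.2 Algorithm N] -/
theorem card_spanV (L : List (List Bool)) : (spanV n L).card = 2 ^ Module.finrank (ZMod 2) (rowSpan n L) := by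
  have h : spanV n L = FinderMachine.VL n L := by
    ext v; rw [mem_spanV, FinderMachine.mem_VL_iff]
  rw [h, FinderMachine.card_VL, finrank_rowSpan_eq_card_pivs, npiv, length_filter_isPiv]

/-- The row span of a concatenation is the join. [folklore] -/
theorem rowSpan_append (A B : List (List Bool)) : rowSpan n (A ++ B) = rowSpan n A ⊔ rowSpan n B := by
  rw [rowSpan, rowSpan, rowSpan, ← Submodule.span_union]
  congr 1
  ext v
  simp only [rowSet, Set.mem_setOf_eq, List.mem_append, Set.mem_union]
  exact ⟨fun ⟨r, hr, hv⟩ => hr.elim (fun h => Or.inl ⟨r, h, hv⟩) fun h => Or.inr ⟨r, h, hv⟩,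
    fun h => h.elim (fun ⟨r, hr, hv⟩ => ⟨r, Or.inl hr, hv⟩) fun ⟨r, hr, hv⟩ => ⟨r, Or.inr hr, hv⟩⟩

/-- The rank read off the reduced form is the dimension of the row span. [cite: KnuthTAOCP2, §4.6.2 Algorithm N] -/
theorem npiv_eq_finrank (M : List (List Bool)) : npiv n (rrun n M) = Module.finrank (ZMod 2) (rowSpan n M) := by
  rw [npiv, length_filter_isPiv, finrank_rowSpan_eq_card_pivs]

/-- **The rank test is span membership.** [cite: KnuthTAOCP2, §4.6.2 Algorithm N] -/
theorem inSpan_eq_true_iff (M : List (List Bool)) (v : List Bool) : inSpan n M v = true ↔ toInput n v ∈ spanV n M := by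
  rw [mem_spanV, ← vecZ_eq_bz]
  unfold inSpan
  rw [decide_eq_true_eq, npiv_eq_finrank, npiv_eq_finrank, rowSpan_append]
  have hle : rowSpan n M ≤ rowSpan n M ⊔ rowSpan n [v] := le_sup_left
  constructor
  · intro h
    have heq : rowSpan n M = rowSpan n M ⊔ rowSpan n [v] := Submodule.eq_of_le_of_finrank_eq hle h.symm
    have hv : vecZ n v ∈ rowSpan n M ⊔ rowSpan n [v] := Submodule.mem_sup_right (vecZ_mem_rowSpan List.mem_cons_self)
    rwa [← heq] at hv
  · intro h
    have : rowSpan n [v] ≤ rowSpan n M := Submodule.span_le.2 (by rintro w ⟨r, hr, rfl⟩; rw [List.mem_singleton.1 hr]; exact h)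
    rw [sup_eq_left.2 this]

/-- The rows of the kernel basis are the kernel vectors of the free columns. [cite: KnuthTAOCP2, §4.6.2 Algorithm N] -/
theorem mem_kerOf_iff (M : List (List Bool)) (r : List Bool) :
    r ∈ kerOf n M ↔ ∃ f : Fin n, isPiv (rrun n M) f = false ∧ r = kvec n (rrun n M) f := by
  unfold kerOf
  rw [List.mem_map]
  constructor
  · rintro ⟨c, hc, rfl⟩
    rw [List.mem_filter, List.mem_range] at hc
    refine ⟨⟨c, hc.1⟩, ?_, rfl⟩
    have h2 := hc.2
    revert h2
    cases isPiv (rrun n M) c <;> intro h2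
    · rfl
    · exact absurd h2 (by decide)
  · rintro ⟨f, hf, rfl⟩
    refine ⟨f, ?_, rfl⟩
    rw [List.mem_filter, List.mem_range]
    exact ⟨f.isLt, by rw [hf]; rfl⟩

/-- The span finset of the kernel basis is the kernel. [cite: KnuthTAOCP2, §4.6.2 Algorithm N] -/
theorem mem_spanV_kerOf_iff (M : List (List Bool)) (v : Fin n → Bool) : v ∈ spanV n (kerOf n M) ↔ bz v ∈ kerSet n M := by
  rw [mem_spanV]
  constructor
  · intro h
    have key : ∀ t ∈ rowSpan n (kerOf n M), t ∈ kerSet n M := by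
      intro t ht
      induction ht using Submodule.span_induction with
      | mem u hu =>
        obtain ⟨r, hr, rfl⟩ := hu
        obtain ⟨f, hf, rfl⟩ := (mem_kerOf_iff M r).1 hr
        exact vecZ_kvec_mem_kerSet hf
      | zero => intro r _; rw [dotZ_comm]; exact dotZ_zero_left _
      | add u w _ _ hu hw => intro r hr; rw [dotZ_add_right, hu r hr, hw r hr, add_zero]
      | smul a u _ hu => intro r hr; rw [dotZ_comm, dotZ_smul_left, dotZ_comm, hu r hr, mul_zero]
    exact key _ h
  · intro h
    rw [eq_sum_kvec_of_mem_kerSet h]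
    refine Submodule.sum_mem _ fun f hf => Submodule.smul_mem _ _ (vecZ_mem_rowSpan ?_)
    exact (mem_kerOf_iff M _).2 ⟨f, mem_frees.1 hf, rfl⟩

/-- **`(ker M)^⊥ ⊆ span M`** in bit vectors: a vector orthogonal to the kernel lies in the span finset.
[cite: VonzurgathenGerhard2013, §12.1] -/
theorem mem_spanV_of_orth_ker {M : List (List Bool)} {x : Fin n → Bool}
    (h : ∀ d : Fin n → Bool, bz d ∈ kerSet n M → (univ.filter fun i => x i && d i).card.bodd = false) : x ∈ spanV n M := by
  rw [mem_spanV]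
  refine mem_rowSpan_of_orth_kerSet fun d hd => ?_
  have := h (zb d) (by rwa [bz_zb])
  rwa [← dotZ_bz_eq_zero_iff, bz_zb] at this

/-! ### The candidate is the kernel parametrisation -/

/-- `List.ofFn (toInput n l) = l` for a list of length `n`. [folklore] -/
theorem ofFn_toInput {l : List Bool} (hl : l.length = n) : List.ofFn (toInput n l) = l := by
  apply List.ext_getElem (by rw [List.length_ofFn, hl])
  intro i h1 h2
  rw [List.getElem_ofFn]
  show l.getD i false = l[i]
  rw [List.getD_eq_getElem?_getD, List.getElem?_eq_getElem h2]; rfl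

/-- **The candidate vector is the kernel parametrisation** `MMReadout.kcV` of the reduced candidate rows (for a
selector of length `n`). [cite: KnuthTAOCP2, §4.6.2 Algorithm N] -/
theorem toInput_candV {cg : PCirc} (S U xs : Mat) {sel : Vec} (hsel : sel.length = n) :
    toInput n (candV n cg S U xs sel) = kcV n (rrun n (candK n cg S U xs)) (toInput n sel) := by
  rw [kcV, ofFn_toInput hsel, candV]

/-- The candidate lies in the kernel of the candidate rows. [cite: KnuthTAOCP2, §4.6.2 Algorithm N] -/
theorem bz_candV_mem_kerSet {cg : PCirc} (S U xs : Mat) {sel : Vec} (hsel : sel.length = n) :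
    bz (toInput n (candV n cg S U xs sel)) ∈ kerSet n (candK n cg S U xs) := by
  rw [toInput_candV S U xs hsel, bz_kcV]; exact sum_smul_kvec_mem_kerSet _

/-- **Fibres of the candidate**, kernel case: a kernel vector is hit by exactly `2^{#pivs}` selectors.
[cite: KnuthTAOCP2, §4.6.2 Algorithm N] -/
theorem card_filter_kcV_eq_of_mem (M : List (List Bool)) {v : Fin n → Bool} (hv : bz v ∈ kerSet n M) :
    (univ.filter fun w : Fin n → Bool => kcV n (rrun n M) w = v).card = 2 ^ (pivs n (rrun n M)).card := by
  classical
  have hfib : (univ.filter fun w : Fin n → Bool => kcV n (rrun n M) w = v) =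
      univ.filter fun w : Fin n → Bool => ∑ f ∈ frees n (rrun n M), toZ (w f) • vecZ n (kvec n (rrun n M) f) = bz v := by
    ext w; simp only [mem_filter, mem_univ, true_and]; rw [← bz_kcV, bz_injective.eq_iff]
  rw [hfib]
  exact card_filter_sum_smul_kvec_eq hv

/-- **Fibres of the candidate**, non-kernel case: a vector outside the kernel is never hit.
[cite: KnuthTAOCP2, §4.6.2 Algorithm N] -/
theorem card_filter_kcV_eq_zero (M : List (List Bool)) {v : Fin n → Bool} (hv : bz v ∉ kerSet n M) :
    (univ.filter fun w : Fin n → Bool => kcV n (rrun n M) w = v).card = 0 := by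
  rw [card_eq_zero, filter_eq_empty_iff]
  intro w _ hw
  refine hv ?_
  rw [← hw, bz_kcV]
  exact sum_smul_kvec_mem_kerSet _

/-- **The rank test is span membership** (registered brick `grow_inSpanIff` of stub `stub_growFinder`, line `dual-pingpong-frame`, crux stmt-QuantumAdvantage-13932). [cite: KnuthTAOCP2, §4.6.2 Algorithm N] -/
theorem grow_inSpanIff : ∀ {n : ℕ} (M : List (List Bool)) (v : List Bool), FinderMachine.inSpan n M v = true ↔ ForrCode.toInput n v ∈ MMReadout.spanV n M :=
  fun M v => inSpan_eq_true_iff M v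

end Summit.QuantumAdvantage.QuantumAdvantage.Theorems.SignedExactCubicForrelationNotPrBPP.GrowMachine

end
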